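import Summits.CriticalPhenomena.SAWScalingLimit.Theses.SAWFrontierHomotopy
import Summits.CriticalPhenomena.SAWScalingLimit.Theorems.AvoidanceLimit.Negative.AvoidanceLimitExponentRigidity
import Summits.CriticalPhenomena.SAWScalingLimit.Theorems.SAWFrontierHomotopyOneSidedPowerLawPentagonWitness
import Literature.Probability.RandomPlanarGeometry.OneSidedPullbackHull
import HarnessLib

/-!
# Negative knowledge on crux `OneSidedPowerLaw` (stmt-CriticalPhenomena-10702), part 3:
# the exponent is rigid — unique and strictly positive

Support file (line lead, route SAWFrontierHomotopy) for the crux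
`Summit.CriticalPhenomena.SAWScalingLimit.Theses.SAWFrontierHomotopy.OneSidedPowerLaw`: "there is ONE exponent
`α : ℝ` such that for every Dobrushin domain `(D; a, b)`, endpoint approximation, hull subdomain `D'` whose
pulled-back hull is a plus- OR minus-hull and restriction data `(Φ, d = Φ'_A(0))`,
`P_δ[range γ_δ ⊆ closure D'] → d ^ α` as `δ → 0+`". `OneSidedPowerLawExp α` below is the body of the crux
with the exponent as a parameter, so that `OneSidedPowerLaw ↔ ∃ α, OneSidedPowerLawExp α` (`Iff.rfl`).
PROVED here, unconditionally (no SAW input beyond "`SAW.law` has total mass `≤ 1`"):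

* `OneSidedPowerLawExp.sum_rpow_le_one` — **disjoint one-sided avoidance events**: in the square
  `bigSq = (-2,2)²` marked at `2`, `-2`, the two pentagons `P₊` (the square minus the closed triangle
  `{y ≥ -1/2 + (5/4)|x|}`, hanging from the top side) and `P₋` (its mirror, hanging from the bottom side)
  are one-sided hull subdomains (part 1 `…PentagonWitness`, one-sidedness by
  `Literature.Probability.RandomPlanarGeometry.isPlusHull_or_isMinusHull_pullbackHull`) with
  `closure P₊ ∩ closure P₋ ⊆ {|Re z| ≥ 2/5}`; a lattice polyline from `a_δ ≈ 2` to `b_δ ≈ -2` is connected,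
  so it cannot stay in both closures: the two avoidance events are DISJOINT for small `δ`, their
  probabilities sum to `≤ 1`, and in the limit `d₊ ^ α + d₋ ^ α ≤ 1` with `0 < d± < 1`;
* `not_oneSidedPowerLawExp_of_nonpos` — hence **no exponent `α ≤ 0` can hold** (`d ^ α ≥ 1`);
* `OneSidedPowerLawExp.unique` — **at most one exponent can hold** (`0 < d₊ < 1` by the tree's
  `restrictionDeriv_lt_one`, and `d₊ ^ p = d₊ ^ q` forces `p = q`);
* `oneSidedPowerLaw_iff_existsUnique`, `oneSidedPowerLaw_iff_exists_pos`, `OneSidedPowerLawExp.pos`,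
  `OneSidedPowerLawExp.exists_rpow_le_half` — so the `∃ α` of the crux is RIGID: if the crux holds, its
  exponent is unique, positive, and satisfies `d ^ α ≤ 1/2` for an explicit restriction derivative
  `d ∈ (0,1)` (conjecturally `α = 5/8`).

Moral for the line: the crux cannot be closed by any exponent-blind or sign-blind argument, and the
degenerate branches `α ≤ 0` of its `∃ α` are excluded by soft means; every remaining constraint on `α`
needs SAW-specific asymptotics. [folklore]
-/

noncomputable section

open Set Filter Topology MeasureTheory Complex Metric
open UpperHalfPlane (upperHalfPlaneSet isOpen_upperHalfPlaneSet)
open Literature.Probability.RandomPlanarGeometry Literature.Probability.LatticeModels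
open Summit.CriticalPhenomena.SAWScalingLimit.Theses.SAWFrontierHomotopy (OneSidedPowerLaw)
open Summit.CriticalPhenomena.SAWScalingLimit.Theorems.AvoidanceLimit.Negative
  (bigSq bigSq_carrier bigSq_pt_zero bigSq_pt_one map_law_apply_le_one restrictionDeriv_lt_one)

namespace Summit.CriticalPhenomena.SAWScalingLimit.Theorems.OneSidedPowerLaw.Negative

/-! ### The one-parameter family of statements -/

/-- The crux `OneSidedPowerLaw` with its exponent as a parameter `α` (body verbatim). -/
def OneSidedPowerLawExp (α : ℝ) : Prop :=
  ∀ (D : DobrushinDomain) (a b : ℝ → Site 2), SAW.IsEndpointApprox D a b →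
    ∀ (D' : DobrushinDomain), (D'.carrier ⊆ D.carrier ∧ D'.pt 0 = D.pt 0 ∧ D'.pt 1 = D.pt 1 ∧
      D.pt 0 ∉ closure (D.carrier \ D'.carrier) ∧ D.pt 1 ∉ closure (D.carrier \ D'.carrier)) →
    ∀ (φ : ConformalEquiv upperHalfPlaneSet D.carrier), D.IsChordalUniformizing φ →
    (IsPlusHull (closure (upperHalfPlaneSet \ {z : ℂ | z ∈ upperHalfPlaneSet ∧ φ z ∈ D'.carrier})) ∨
      IsMinusHull (closure (upperHalfPlaneSet \ {z : ℂ | z ∈ upperHalfPlaneSet ∧ φ z ∈ D'.carrier}))) →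
    ∀ (Φ : ConformalEquiv (upperHalfPlaneSet \ closure (upperHalfPlaneSet \
        {z : ℂ | z ∈ upperHalfPlaneSet ∧ φ z ∈ D'.carrier})) upperHalfPlaneSet) (d : ℝ),
      IsRestrictionMap (closure (upperHalfPlaneSet \ {z : ℂ | z ∈ upperHalfPlaneSet ∧ φ z ∈ D'.carrier})) Φ →
      HasRestrictionDeriv (closure (upperHalfPlaneSet \ {z : ℂ | z ∈ upperHalfPlaneSet ∧ φ z ∈ D'.carrier})) Φ d →
      Tendsto (fun δ => ((SAW.law D.carrier δ (a δ) (b δ)).map (fun γ => γ.curve))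
        (CurveClass.rangeSubset (closure D'.carrier))) (𝓝[>] 0) (𝓝 (ENNReal.ofReal (d ^ α)))

/-- The crux is `∃ α, OneSidedPowerLawExp α`, definitionally. -/
theorem oneSidedPowerLaw_iff_exists : OneSidedPowerLaw ↔ ∃ α : ℝ, OneSidedPowerLawExp α := Iff.rfl

/-! ### The pentagons as admissible data of the crux -/

/-- **The pentagon of sign `ε` is admissible crux data in `bigSq`.** For every chordal uniformizer `φ`
of `bigSq = ((-2,2)²; 2, -2)`: the pentagon `P` (part 1) satisfies the five hull-subdomain clauses, its
pulled-back hull is a plus- or a minus-hull (its removed triangle meets `∂bigSq` only in the top/bottom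
side, a segment avoiding `±2`), and it carries restriction data `(Φ, d)` with `0 < d < 1` (the removed
triangle has interior, `restrictionDeriv_lt_one`). [folklore] -/
theorem exists_pent_config {ε : ℝ} (hε : ε = 1 ∨ ε = -1)
    (φ : ConformalEquiv upperHalfPlaneSet bigSq.carrier) (hφ : bigSq.IsChordalUniformizing φ) :
    ∃ P : DobrushinDomain, P.carrier = {z : ℂ | z ∈ symRect 2 2 ∧ ε * z.im < -1 / 2 + 5 / 4 * |z.re|} ∧
      (P.carrier ⊆ bigSq.carrier ∧ P.pt 0 = bigSq.pt 0 ∧ P.pt 1 = bigSq.pt 1 ∧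
        bigSq.pt 0 ∉ closure (bigSq.carrier \ P.carrier) ∧
        bigSq.pt 1 ∉ closure (bigSq.carrier \ P.carrier)) ∧
      (IsPlusHull (φ.pullbackHull P) ∨ IsMinusHull (φ.pullbackHull P)) ∧
      ∃ (Φ : ConformalEquiv (upperHalfPlaneSet \ φ.pullbackHull P) upperHalfPlaneSet) (d : ℝ),
        IsRestrictionMap (φ.pullbackHull P) Φ ∧ HasRestrictionDeriv (φ.pullbackHull P) Φ d ∧
          0 < d ∧ d < 1 := by
  obtain ⟨P, hPc, hP0, hP1⟩ := exists_pentDomain hε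
  have hcl : P.carrier ⊆ bigSq.carrier ∧ P.pt 0 = bigSq.pt 0 ∧ P.pt 1 = bigSq.pt 1 ∧
      bigSq.pt 0 ∉ closure (bigSq.carrier \ P.carrier) ∧
      bigSq.pt 1 ∉ closure (bigSq.carrier \ P.carrier) := by
    rw [bigSq_pt_zero, bigSq_pt_one, bigSq_carrier, hPc, hP0, hP1]
    exact ⟨pentSet_subset ε, rfl, rfl, two_notMem_closure_diff hε, neg_two_notMem_closure_diff hε⟩
  have hD' : bigSq.IsHullSubdomain P := hcl
  have hside : IsPlusHull (φ.pullbackHull P) ∨ IsMinusHull (φ.pullbackHull P) := by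
    refine isPlusHull_or_isMinusHull_pullbackHull hφ hD' (isPreconnected_topSide ε)
      (isClosed_topSide ε) ?_ ?_ ?_ ?_
    · rw [bigSq_carrier]; exact topSide_subset_frontier hε
    · rw [bigSq_pt_zero]; exact two_notMem_topSide hε
    · rw [bigSq_pt_one]; exact neg_two_notMem_topSide hε
    · rw [bigSq_carrier, hPc]; exact closure_diff_inter_frontier_subset hε
  have hstar : IsStarHull (φ.pullbackHull P) :=
    IsStarHull.pullbackHull JordanDomain.isSimplyConnected_holds hφ hD'
  obtain ⟨Φ, hΦ, -⟩ := IsStarHull.existsUnique_isRestrictionMap_holds hstar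
  obtain ⟨d, hd0, -, hd⟩ := IsStarHull.exists_hasRestrictionDeriv_holds hstar hΦ
  -- the removed triangle has interior: `φ⁻¹ w ∈ A ∩ ℍ` for a point `w` of the square off the pentagon
  have hne : (φ.pullbackHull P ∩ upperHalfPlaneSet).Nonempty := by
    obtain ⟨w, hw, hwP⟩ := exists_mem_symRect_notMem_pentSet hε
    have hwD : w ∈ bigSq.carrier := by rw [bigSq_carrier]; exact hw
    have hz : φ.symm w ∈ upperHalfPlaneSet := φ.symm_mapsTo hwD
    refine ⟨φ.symm w, subset_closure ⟨hz, ?_⟩, hz⟩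
    rintro ⟨-, h⟩
    rw [φ.apply_symm_apply hwD, hPc] at h
    exact hwP h
  exact ⟨P, hPc, hcl, hside, Φ, d, hΦ, hd, hd0, restrictionDeriv_lt_one hstar hΦ hd hne⟩

/-! ### Lattice polylines are connected and join the endpoints -/

/-- The total mass of the critical SAW law is at most `1` (it is `0` or a probability measure).
[folklore] -/
theorem law_univ_le_one (Ω : Set ℂ) (δ : ℝ) (a b : Site 2) : SAW.law Ω δ a b univ ≤ 1 := by
  have h := map_law_apply_le_one Ω δ a b univ
  rwa [Measure.map_apply (SAW.DomainSAW.measurable_of_top _) MeasurableSet.univ, preimage_univ] at h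

/-- The trace of the polyline of a SAW is preconnected and contains the mesh points of both endpoints.
[folklore] -/
theorem curve_range_props {Ω : Set ℂ} {δ : ℝ} {a b : Site 2} (γ : SAW.DomainSAW Ω δ a b) :
    IsPreconnected γ.curve.range ∧ meshPoint δ a ∈ γ.curve.range ∧ meshPoint δ b ∈ γ.curve.range := by
  have hr : γ.curve.range = Set.range (γ.walk.toCurve (meshPoint δ)) := rfl
  rw [hr]
  exact ⟨(isPreconnected_range (γ.walk.toCurve (meshPoint δ)).continuous),
    SimpleGraph.Walk.mem_range_toCurve _ _ γ.walk.start_mem_support,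
    SimpleGraph.Walk.mem_range_toCurve _ _ γ.walk.end_mem_support⟩

/-- **The two avoidance events are disjoint for walks from near `2` to near `-2`.** A SAW of `bigSq_δ`
whose endpoints have mesh points within distance `1` of `2` and `-2` cannot have its polyline inside both
closed pentagons: the trace is preconnected, joins a point of real part `> 1` to one of real part `< -1`,
so it passes through `Re z = 0`, but `closure P₊ ∩ closure P₋ ⊆ {|Re z| ≥ 2/5}`. [folklore] -/
theorem disjoint_preimage_rangeSubset {δ : ℝ} {u v : Site 2}
    (hu : meshPoint δ u ∈ ball (2 : ℂ) 1) (hv : meshPoint δ v ∈ ball (-2 : ℂ) 1) :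
    Disjoint ((fun γ : SAW.DomainSAW bigSq.carrier δ u v ↦ γ.curve) ⁻¹'
        CurveClass.rangeSubset (closure {z : ℂ | z ∈ symRect 2 2 ∧ (1 : ℝ) * z.im < -1 / 2 + 5 / 4 * |z.re|}))
      ((fun γ : SAW.DomainSAW bigSq.carrier δ u v ↦ γ.curve) ⁻¹'
        CurveClass.rangeSubset (closure {z : ℂ | z ∈ symRect 2 2 ∧ (-1 : ℝ) * z.im < -1 / 2 + 5 / 4 * |z.re|})) := by
  rw [Set.disjoint_left]
  intro γ h1 h2
  obtain ⟨hconn, hsrc, htgt⟩ := curve_range_props γ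
  have key : ∀ w c : ℂ, w ∈ ball c 1 → |w.re - c.re| < 1 := fun w c hw ↦ by
    have h := abs_re_le_norm (w - c)
    rw [sub_re] at h
    rw [mem_ball, dist_eq_norm] at hw
    exact lt_of_le_of_lt h hw
  have hre_u : 1 < (meshPoint δ u).re := by
    have h := key _ _ hu
    have h2 : (2 : ℂ).re = 2 := by norm_num
    rw [h2] at h
    linarith [(abs_lt.1 h).1]
  have hre_v : (meshPoint δ v).re < -1 := by
    have h := key _ _ hv
    have h2 : (-2 : ℂ).re = -2 := by norm_num
    rw [h2] at h
    linarith [(abs_lt.1 h).2]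
  obtain ⟨z, hz, hz0⟩ : ∃ z ∈ γ.curve.range, z.re = 0 := by
    have hI := hconn.intermediate_value htgt hsrc continuous_re.continuousOn
    have h0 : (0 : ℝ) ∈ Icc (meshPoint δ v).re (meshPoint δ u).re := ⟨by linarith, by linarith⟩
    obtain ⟨z, hz, hz0⟩ := hI h0
    exact ⟨z, hz, hz0⟩
  have key := abs_re_ge_of_mem_closure_inter (h1 hz) (h2 hz)
  rw [hz0, abs_zero] at key
  linarith

/-! ### Disjoint one-sided avoidance events: `d₊ ^ α + d₋ ^ α ≤ 1` -/

/-- **Main estimate.** If `OneSidedPowerLawExp α` holds then the restriction derivatives `d₊, d₋ ∈ (0,1)`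
of the two pentagons (for some chordal uniformizer of `bigSq`) satisfy `d₊ ^ α + d₋ ^ α ≤ 1`: the two
avoidance probabilities converge to `d± ^ α`, and they sum to at most `1` for small `δ` because the two
events are disjoint. [folklore] -/
theorem OneSidedPowerLawExp.sum_rpow_le_one {α : ℝ} (h : OneSidedPowerLawExp α) :
    ∃ d₁ d₂ : ℝ, 0 < d₁ ∧ d₁ < 1 ∧ 0 < d₂ ∧ d₂ < 1 ∧ d₁ ^ α + d₂ ^ α ≤ 1 := by
  obtain ⟨a, b, hab⟩ := SAW.exists_isEndpointApprox bigSq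
  obtain ⟨φ, hφ⟩ := MarkedDomain.exists_isChordalUniformizing_holds bigSq
  obtain ⟨P₁, hP₁c, hcl₁, hside₁, Φ₁, d₁, hΦ₁, hd₁, hd₁0, hd₁1⟩ :=
    exists_pent_config (Or.inl rfl) φ hφ
  obtain ⟨P₂, hP₂c, hcl₂, hside₂, Φ₂, d₂, hΦ₂, hd₂, hd₂0, hd₂1⟩ :=
    exists_pent_config (Or.inr rfl) φ hφ
  have key₁ := h bigSq a b hab P₁ hcl₁ φ hφ hside₁ Φ₁ d₁ hΦ₁ hd₁
  have key₂ := h bigSq a b hab P₂ hcl₂ φ hφ hside₂ Φ₂ d₂ hΦ₂ hd₂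
  -- eventually the endpoints are near `2` and `-2`
  have hA : ∀ᶠ δ in 𝓝[>] (0 : ℝ), meshPoint δ (a δ) ∈ ball (2 : ℂ) 1 := by
    have := hab.tendsto_fst
    rw [bigSq_pt_zero] at this
    exact this (ball_mem_nhds _ one_pos)
  have hB : ∀ᶠ δ in 𝓝[>] (0 : ℝ), meshPoint δ (b δ) ∈ ball (-2 : ℂ) 1 := by
    have := hab.tendsto_snd
    rw [bigSq_pt_one] at this
    exact this (ball_mem_nhds _ one_pos)
  -- so the two avoidance probabilities sum to at most `1`
  have hev : ∀ᶠ δ in 𝓝[>] (0 : ℝ),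
      ((SAW.law bigSq.carrier δ (a δ) (b δ)).map (fun γ ↦ γ.curve))
          (CurveClass.rangeSubset (closure P₁.carrier)) +
        ((SAW.law bigSq.carrier δ (a δ) (b δ)).map (fun γ ↦ γ.curve))
          (CurveClass.rangeSubset (closure P₂.carrier)) ≤ 1 := by
    filter_upwards [hA, hB] with δ ha hb
    have hm : Measurable (fun γ : SAW.DomainSAW bigSq.carrier δ (a δ) (b δ) ↦ γ.curve) :=
      SAW.DomainSAW.measurable_of_top _
    rw [Measure.map_apply hm (CurveClass.measurableSet_rangeSubset isClosed_closure),
      Measure.map_apply hm (CurveClass.measurableSet_rangeSubset isClosed_closure), hP₁c, hP₂c,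
      ← measure_union (disjoint_preimage_rangeSubset ha hb) MeasurableSpace.measurableSet_top]
    exact (measure_mono (subset_univ _)).trans (law_univ_le_one _ _ _ _)
  have hle : ENNReal.ofReal (d₁ ^ α) + ENNReal.ofReal (d₂ ^ α) ≤ 1 :=
    le_of_tendsto (key₁.add key₂) hev
  rw [← ENNReal.ofReal_add (Real.rpow_nonneg hd₁0.le α) (Real.rpow_nonneg hd₂0.le α),
    ← ENNReal.ofReal_one, ENNReal.ofReal_le_ofReal_iff zero_le_one] at hle
  exact ⟨d₁, d₂, hd₁0, hd₁1, hd₂0, hd₂1, hle⟩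

/-! ### Consequences: no nonpositive exponent, a quantitative bound, uniqueness -/

/-- **No exponent `α ≤ 0` can hold** (unconditionally): `d ^ α ≥ 1` for `d ∈ (0, 1]`, so
`d₊ ^ α + d₋ ^ α ≥ 2 > 1`. In particular the degenerate branch `α = 0` of the crux's `∃ α` (avoidance
probabilities of every one-sided hull subdomain tending to `1`) is refuted. [folklore] -/
theorem not_oneSidedPowerLawExp_of_nonpos {α : ℝ} (hα : α ≤ 0) : ¬ OneSidedPowerLawExp α := by
  intro h
  obtain ⟨d₁, d₂, hd₁0, hd₁1, hd₂0, hd₂1, hsum⟩ := h.sum_rpow_le_one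
  have h1 : 1 ≤ d₁ ^ α := Real.one_le_rpow_of_pos_of_le_one_of_nonpos hd₁0 hd₁1.le hα
  have h2 : 1 ≤ d₂ ^ α := Real.one_le_rpow_of_pos_of_le_one_of_nonpos hd₂0 hd₂1.le hα
  linarith

/-- An admissible exponent is strictly positive. [folklore] -/
theorem OneSidedPowerLawExp.pos {α : ℝ} (h : OneSidedPowerLawExp α) : 0 < α :=
  lt_of_not_ge fun hle ↦ not_oneSidedPowerLawExp_of_nonpos hle h

/-- **Quantitative form**: an admissible exponent satisfies `d ^ α ≤ 1/2` for some explicit restriction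
derivative `d ∈ (0, 1)` (the smaller of `d₊, d₋`), i.e. `α ≥ log 2 / log (1/d)`. [folklore] -/
theorem OneSidedPowerLawExp.exists_rpow_le_half {α : ℝ} (h : OneSidedPowerLawExp α) :
    ∃ d : ℝ, 0 < d ∧ d < 1 ∧ d ^ α ≤ 1 / 2 := by
  obtain ⟨d₁, d₂, hd₁0, hd₁1, hd₂0, hd₂1, hsum⟩ := h.sum_rpow_le_one
  rcases le_total (d₁ ^ α) (d₂ ^ α) with hle | hle
  · exact ⟨d₁, hd₁0, hd₁1, by linarith⟩
  · exact ⟨d₂, hd₂0, hd₂1, by linarith⟩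

/-- **At most one exponent can hold**: the avoidance probabilities of the pentagon `P₊` converge to
`d₊ ^ p` and to `d₊ ^ q` with `0 < d₊ < 1`, so `p = q`. [folklore] -/
theorem OneSidedPowerLawExp.unique {p q : ℝ} (hp : OneSidedPowerLawExp p) (hq : OneSidedPowerLawExp q) :
    p = q := by
  obtain ⟨a, b, hab⟩ := SAW.exists_isEndpointApprox bigSq
  obtain ⟨φ, hφ⟩ := MarkedDomain.exists_isChordalUniformizing_holds bigSq
  obtain ⟨P, -, hcl, hside, Φ, d, hΦ, hd, hd0, hd1⟩ := exists_pent_config (Or.inl rfl) φ hφ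
  have kp := hp bigSq a b hab P hcl φ hφ hside Φ d hΦ hd
  have kq := hq bigSq a b hab P hcl φ hφ hside Φ d hΦ hd
  have heq : ENNReal.ofReal (d ^ p) = ENNReal.ofReal (d ^ q) := tendsto_nhds_unique kp kq
  rw [ENNReal.ofReal_eq_ofReal_iff (Real.rpow_nonneg hd0.le p) (Real.rpow_nonneg hd0.le q)] at heq
  have hlog := congrArg Real.log heq
  rw [Real.log_rpow hd0, Real.log_rpow hd0] at hlog
  exact mul_right_cancel₀ (Real.log_neg hd0 hd1).ne hlog

/-- No two distinct exponents can hold simultaneously. [folklore] -/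
theorem not_oneSidedPowerLawExp_and {p q : ℝ} (hpq : p ≠ q) :
    ¬ (OneSidedPowerLawExp p ∧ OneSidedPowerLawExp q) :=
  fun h ↦ hpq (h.1.unique h.2)

/-- **The crux has a rigid exponent**: `OneSidedPowerLaw ↔ ∃! α, OneSidedPowerLawExp α`. [folklore] -/
theorem oneSidedPowerLaw_iff_existsUnique : OneSidedPowerLaw ↔ ∃! α : ℝ, OneSidedPowerLawExp α := by
  rw [oneSidedPowerLaw_iff_exists]
  constructor
  · rintro ⟨α, hα⟩
    exact ⟨α, hα, fun β hβ ↦ hβ.unique hα⟩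
  · rintro ⟨α, hα, -⟩
    exact ⟨α, hα⟩

/-- **… and that exponent is positive**: `OneSidedPowerLaw ↔ ∃ α > 0, OneSidedPowerLawExp α`. [folklore] -/
theorem oneSidedPowerLaw_iff_exists_pos :
    OneSidedPowerLaw ↔ ∃ α : ℝ, 0 < α ∧ OneSidedPowerLawExp α := by
  rw [oneSidedPowerLaw_iff_exists]
  constructor
  · rintro ⟨α, hα⟩
    exact ⟨α, hα.pos, hα⟩
  · rintro ⟨α, -, hα⟩
    exact ⟨α, hα⟩

/-- Under the crux, the variant with any OTHER exponent is false (e.g. under the conjectured `α = 5/8`,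
the Brownian-excursion value `1` and the Ising value `1/2` are excluded). [folklore] -/
theorem OneSidedPowerLawExp.not_exp_of_ne {α β : ℝ} (h : OneSidedPowerLawExp α) (hne : β ≠ α) :
    ¬ OneSidedPowerLawExp β :=
  fun hβ ↦ hne (hβ.unique h)

/-! ### Def-free export (the statement registered on the crux skeleton) -/

/-- **Registered stub `stub_exponentRigidity`** (definition-free, the form registered on the skeleton of crux
stmt-CriticalPhenomena-10702, line `birth`): if the body of `OneSidedPowerLaw` holds with exponent `α`, then `α > 0`
and every exponent for which the body holds equals `α`. [folklore] -/
theorem stub_exponentRigidity : ∀ α : ℝ,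
    (∀ (D : DobrushinDomain) (a b : ℝ → Site 2), SAW.IsEndpointApprox D a b →
      ∀ (D' : DobrushinDomain), (D'.carrier ⊆ D.carrier ∧ D'.pt 0 = D.pt 0 ∧ D'.pt 1 = D.pt 1 ∧
        D.pt 0 ∉ closure (D.carrier \ D'.carrier) ∧ D.pt 1 ∉ closure (D.carrier \ D'.carrier)) →
      ∀ (φ : ConformalEquiv upperHalfPlaneSet D.carrier), D.IsChordalUniformizing φ →
      (IsPlusHull (closure (upperHalfPlaneSet \ {z : ℂ | z ∈ upperHalfPlaneSet ∧ φ z ∈ D'.carrier})) ∨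
        IsMinusHull (closure (upperHalfPlaneSet \ {z : ℂ | z ∈ upperHalfPlaneSet ∧ φ z ∈ D'.carrier}))) →
      ∀ (Φ : ConformalEquiv (upperHalfPlaneSet \ closure (upperHalfPlaneSet \
          {z : ℂ | z ∈ upperHalfPlaneSet ∧ φ z ∈ D'.carrier})) upperHalfPlaneSet) (d : ℝ),
        IsRestrictionMap (closure (upperHalfPlaneSet \ {z : ℂ | z ∈ upperHalfPlaneSet ∧ φ z ∈ D'.carrier})) Φ →
        HasRestrictionDeriv (closure (upperHalfPlaneSet \ {z : ℂ | z ∈ upperHalfPlaneSet ∧ φ z ∈ D'.carrier})) Φ d →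
        Tendsto (fun δ => ((SAW.law D.carrier δ (a δ) (b δ)).map (fun γ => γ.curve))
          (CurveClass.rangeSubset (closure D'.carrier))) (𝓝[>] 0) (𝓝 (ENNReal.ofReal (d ^ α)))) →
    0 < α ∧ ∀ β : ℝ,
    (∀ (D : DobrushinDomain) (a b : ℝ → Site 2), SAW.IsEndpointApprox D a b →
      ∀ (D' : DobrushinDomain), (D'.carrier ⊆ D.carrier ∧ D'.pt 0 = D.pt 0 ∧ D'.pt 1 = D.pt 1 ∧
        D.pt 0 ∉ closure (D.carrier \ D'.carrier) ∧ D.pt 1 ∉ closure (D.carrier \ D'.carrier)) →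
      ∀ (φ : ConformalEquiv upperHalfPlaneSet D.carrier), D.IsChordalUniformizing φ →
      (IsPlusHull (closure (upperHalfPlaneSet \ {z : ℂ | z ∈ upperHalfPlaneSet ∧ φ z ∈ D'.carrier})) ∨
        IsMinusHull (closure (upperHalfPlaneSet \ {z : ℂ | z ∈ upperHalfPlaneSet ∧ φ z ∈ D'.carrier}))) →
      ∀ (Φ : ConformalEquiv (upperHalfPlaneSet \ closure (upperHalfPlaneSet \
          {z : ℂ | z ∈ upperHalfPlaneSet ∧ φ z ∈ D'.carrier})) upperHalfPlaneSet) (d : ℝ),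
        IsRestrictionMap (closure (upperHalfPlaneSet \ {z : ℂ | z ∈ upperHalfPlaneSet ∧ φ z ∈ D'.carrier})) Φ →
        HasRestrictionDeriv (closure (upperHalfPlaneSet \ {z : ℂ | z ∈ upperHalfPlaneSet ∧ φ z ∈ D'.carrier})) Φ d →
        Tendsto (fun δ => ((SAW.law D.carrier δ (a δ) (b δ)).map (fun γ => γ.curve))
          (CurveClass.rangeSubset (closure D'.carrier))) (𝓝[>] 0) (𝓝 (ENNReal.ofReal (d ^ β)))) →
    β = α :=
  fun _ hα => ⟨OneSidedPowerLawExp.pos hα, fun _ hβ => OneSidedPowerLawExp.unique hβ hα⟩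

end Summit.CriticalPhenomena.SAWScalingLimit.Theorems.OneSidedPowerLaw.Negative

end
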